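import Summits.BirchSwinnertonDyer.BirchSwinnertonDyer.Theses.BiquadraticEisensteinDescent
import Summits.BirchSwinnertonDyer.BirchSwinnertonDyer.Theorems.BiquadraticEisensteinDescentHeegnerFieldSupplyAdmissibilityDescends
import HarnessLib

/-!
# Route `BiquadraticEisensteinDescent`: the K′-form supply crux KS_R (stmt-BirchSwinnertonDyer-20713) is a PURE WEAKENING
# of the quartic-admissibility supply crux KS (stmt-BirchSwinnertonDyer-20198, now aside) — provenance in the kernel

Seat `bsd-wall-bed-p2` (prover g7, cell `bsd-wall`, W-ALL row 12 · K12i). Director-bsd rulings W-16/W-18 «Δ-h⁻» (2026-08-27)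
replaced the route's supply crux `HeegnerFieldSupplyCMInertBadAdm` (∃ K′ imaginary quadratic with `|d_K′| > 4`, Heegner for
`N_W`, `L(W^{(d_K′)},1) ≠ 0` and `p ∤ h(M)` for EVERY quartic `M ∋ √d_CM, √d_K′`) by its K′-form `HeegnerFieldSupplyCMInertBadKPrime`
(same, with the last conjunct `¬ p ∣ h(K′)`). This file records, against the route decls BY NAME, that the new crux follows from
the old one: the quartic binder applied to the biquadratic field `K_CM·K′` descends to `p ∤ h(K′)` (bed-p2 g6,
`…HeegnerFieldSupplyAdmissibilityDescends.not_dvd_classNumber_heegnerField_of_admissible`, p536456: `p` odd, `h(K_CM) = 1`,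
`√d_CM ∉ K′` since `p` is inert in `K_CM` and split in `K′`). What Δ-h⁻ dropped is exactly the real-quadratic conjunct
`p ∤ h(ℚ(√(d_CM·d_K′)))` (p541759 `heegnerFieldSupplyCMInertBadAdm_iff_quadraticForm`). So any proof of the old KS closes KS_R
(and a refutation of KS_R would refute KS). THEOREMS ONLY (0 definitions, 0 named facts, 0 `sorry`); supports, does not close, 20713.
BSD is not proved by this file. References: [KohnenOno1999] Thm. 1 (class-number indivisibility); [BeckwithRaumRichter2024] Thm. 1.
-/

set_option autoImplicit false

-- D-0017 layout: summit = sub-problem, so `Summit.BirchSwinnertonDyer.BirchSwinnertonDyer.…` is the mandated namespace.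
set_option linter.dupNamespace false

namespace Summit.BirchSwinnertonDyer.BirchSwinnertonDyer.Theorems.BiquadraticEisensteinDescentHeegnerFieldSupplyKPrimeOfAdm

open Summit.BirchSwinnertonDyer.BirchSwinnertonDyer.Theses.BiquadraticEisensteinDescent

/-- **KS (quartic admissibility form, item 20198) ⟹ KS_R (K′-form, item 20713).** For every pair `(W, p)` of the CM
inert-bad corner, a Heegner field `K′` supplied by `HeegnerFieldSupplyCMInertBadAdm` (with `p ∤ h(M)` for every quartic
`M ∋ √d_CM, √d_K′`) already satisfies `p ∤ h(K′)`; the other four conjuncts are identical. Proof: bed-p2 g6's descent lemma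
`not_dvd_classNumber_heegnerField_of_admissible` (p536456) at `p ≥ 5`. [cite: KohnenOno1999, Thm. 1 p. 388 (Invent. Math. 135)] -/
theorem heegnerFieldSupplyCMInertBadKPrime_of_adm (h : HeegnerFieldSupplyCMInertBadAdm) :
    HeegnerFieldSupplyCMInertBadKPrime := by
  intro W _ _ p _ _ hCM hr hp5 hin hbad
  obtain ⟨K, _, _, hK, hd4, hHN, hLt, hadm⟩ := h W p hCM hr hp5 hin hbad
  exact ⟨K, inferInstance, inferInstance, hK, hd4, hHN, hLt,
    BiquadraticEisensteinDescentHeegnerFieldSupplyAdmissibilityDescends.not_dvd_classNumber_heegnerField_of_admissible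
      W (by omega) hin hbad K hK hHN hadm⟩

end Summit.BirchSwinnertonDyer.BirchSwinnertonDyer.Theorems.BiquadraticEisensteinDescentHeegnerFieldSupplyKPrimeOfAdm
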